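import Literature.Topology.FourManifolds.TrisectionsCornerModel
import Literature.Topology.FourManifolds.RegularSublevelSet
import HarnessLib

/-!
# Sectors with corners along a surface: the straightened smooth atlas (corner-slice charts)

Topic `Literature/Topology/FourManifolds`; infrastructure for the fact seat
`provefact-Literature.Topology.FourManifolds.exists_isBalancedGKTrisection` (Gay–Kirby 2016,
Thm. 4, over the corrected predicate `Literature.Topology.FourManifolds.IsGKTrisection` of
`Trisections.lean`).  Everything in this file is **proved**; no named facts are introduced.

Clause (ii) of `IsGKTrisection` asks that each sector `S ⊆ X` of a trisection be the image of a
topological embedding `e : W → X` of a smooth `4`-manifold with boundary `W` which is a `C^∞`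
immersion off the central surface `F` and has a *corner chart*
(`Literature.Topology.FourManifolds.IsCornerAt`: `ψ ∘ e ∘ φ⁻¹ = A ∘ cornerUnbend`) at every
point over `F`.  Part (b) of the section docstring *Corrected predicate* of `Trisections.lean`
describes how such a `W` is obtained from a closed subset `S ⊆ X` which is, in suitable smooth
charts of `X`, a half-space at its ordinary boundary points and the model quadrant
`Q = cornerQuadrant` at the points of `F` ("the atlas: charts of `X` at interior points, half-space
charts at points of `H ∖ F`, and at points of `F` the corner charts `cornerFold ∘ A⁻¹ ∘ (χ × id) ∘ Θ`;
a transition map between two corner charts is `cornerFold ∘ (id × χ'χ⁻¹) ∘ cornerUnbend = id × χ'χ⁻¹`,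
all other transition maps live off the corner stratum, where `cornerUnbend` is a local
diffeomorphism"), and `SphereTrisectionsSectors.lean` carries this out for the explicit sectors
of the round `S⁴`.  This file carries it out **in general**, as reusable infrastructure on top
of the half-slice charts of `RegularSublevelSet.lean` (`Literature.Topology.FourManifolds.HalfSliceChart`:
local diffeomorphisms `Θ` of the ambient manifold in which `S` is the half-space) and the
corner-model calculus of `TrisectionsCornerModel.lean`:

* `Literature.Topology.FourManifolds.CornerSliceChart S K u v π` — a **corner-slice chart**: a
  local diffeomorphism `Θ` of the ambient boundaryless `4`-manifold `M` into `ℝ⁴` in which `S`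
  is the quadrant (`q ∈ S ↔ Θ q ∈ Q`), whose two *normal* coordinates are two fixed functions
  `u`, `v` (so that all corner-slice charts share them), whose *tangential* coordinates factor
  through a fixed retraction `π` onto the corner locus `K` (`Θ (π q) = (0, 0, (Θ q)₂, (Θ q)₃)`,
  `π` preserving the chart domain), and in which `K` is the corner stratum `{u = v = 0}`.  The
  point of the last two conditions is the transition map between two corner-slice charts after
  straightening the angle: it is `(x₀, x₁, x') ↦ (x₀, x₁, τ(x'))` (`CornerSliceChart.fold_trans_apply`),
  smooth although `cornerUnbend` is not (in the intended application `u`, `v`, `π` come from a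
  product neighbourhood `F × ℝ²` of the central surface given by two commuting collar flows).
* `CornerSliceChart.chart` — the induced chart of `S`, valued in the half-space model
  `EuclideanHalfSpace 4`: `q ↦ cornerFold (Θ q)` ("the sector with its angle straightened by
  the principal square root"); its target is open by
  `Literature.Topology.FourManifolds.image_cornerFold_inter_cornerQuadrant`; `translate`
  (re-centring the tangential coordinates).
* `Literature.Topology.FourManifolds.CornerSliceAtlas S K u v π` — a half-slice chart avoiding
  `K` at every point of `S ∖ K` and a corner-slice chart at every point of `S ∩ K`; the charted
  space structure `CornerSliceAtlas.chartedSpace` on `S` (atlas: the charts induced by *all*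
  half-slice charts avoiding `K` and *all* corner-slice charts) and
  **`CornerSliceAtlas.isManifold : IsManifold (𝓡∂ 4) ∞ S`** — the four kinds of transition maps
  are smooth: half/half (`HalfSliceChart.contDiffOn_symm_trans`), corner/corner (above),
  half→corner (`cornerFold` is polynomial) and corner→half (off `K` the corner-slice chart takes
  values off the corner stratum, where `cornerUnbend` is smooth within the half-space,
  `Literature.Topology.FourManifolds.contDiffWithinAt_cornerUnbend`).
* With this structure: the inclusion `S → M` is a `C^∞` immersion at every point off `K`
  (`CornerSliceAtlas.isImmersionAt_subtype_val`, Mathlib's `Manifold.IsImmersionAt` with the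
  trivial complement), has a corner chart at every point of `K`
  (**`CornerSliceAtlas.isCornerAt_subtype_val`**, with `A = id`: in the corner-slice chart `Θ`
  of `M` and the induced chart of `S` re-centred at the point, the inclusion reads
  `cornerUnbend`), and the points of `K` as well as the points of `S ∖ K` with vanishing
  half-slice coordinate are boundary points of `S` (`CornerSliceAtlas.isBoundaryPoint_of_mem`,
  `CornerSliceAtlas.isBoundaryPoint_iff_of_not_mem`).

These are exactly the items of clause (ii) of `IsGKTrisection` that concern the smooth
structure of a sector; compactness, connectedness and the handle decomposition of the sector
are separate matters.

## References

* A. Douady, *Variétés à bord anguleux et voisinages tubulaires*, Séminaire H. Cartan 14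
  (1961/62), exp. 1, §1 and §4 (manifolds with corners; the quadrant model). [Douady1961]
* A. Douady, L. Hérault, *Arrondissement des variétés à coins*, appendix to A. Borel,
  J.-P. Serre, *Corners and arithmetic groups*, Comment. Math. Helv. 48 (1973) 436–491
  (straightening the angle). [DouadyHerault1973]
* D. Gay, R. Kirby, *Trisecting 4-manifolds*, Geom. Topol. 20 (2016) 3097–3132
  (arXiv:1205.1565), Def. 1 and Fig. 1. [GayKirby2016]
* J. M. Lee, *Introduction to Smooth Manifolds*, 2nd ed., GTM 218 (2013), Ch. 16, pp. 415–417
  (smooth manifolds with corners, corner points are invariantly defined). [LeeSmoothManifolds2013]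
-/

open scoped Manifold ContDiff Topology
open Set Function

noncomputable section

universe u

namespace Literature.Topology.FourManifolds

/-- Local notation: `𝔼⁴` is the model vector space `EuclideanSpace ℝ (Fin 4)`. -/
local notation "𝔼⁴" => EuclideanSpace ℝ (Fin 4)
/-- Local notation: `ℍ⁴` is the model half-space `EuclideanHalfSpace 4`. -/
local notation "ℍ⁴" => EuclideanHalfSpace 4

/-! ### Small complements on the models -/

section Models

/-- The projection of `ℝ⁴` onto the corner stratum `{x₀ = x₁ = 0}` along the normal plane:
`(x₀, x₁, x₂, x₃) ↦ (0, 0, x₂, x₃)`. [folklore] -/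
def stratumProj (x : 𝔼⁴) : 𝔼⁴ := !₂[0, 0, x 2, x 3]

/-- Coordinate `0` of `stratumProj x` vanishes. [folklore] -/
@[simp] theorem stratumProj_apply_zero (x : 𝔼⁴) : stratumProj x 0 = 0 := rfl
/-- Coordinate `1` of `stratumProj x` vanishes. [folklore] -/
@[simp] theorem stratumProj_apply_one (x : 𝔼⁴) : stratumProj x 1 = 0 := rfl
/-- Coordinate `2` of `stratumProj x` is `x₂`. [folklore] -/
@[simp] theorem stratumProj_apply_two (x : 𝔼⁴) : stratumProj x 2 = x 2 := rfl
/-- Coordinate `3` of `stratumProj x` is `x₃`. [folklore] -/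
@[simp] theorem stratumProj_apply_three (x : 𝔼⁴) : stratumProj x 3 = x 3 := rfl

/-- `stratumProj` is a continuous linear map (written as a plain function); in particular it is
smooth. [folklore] -/
theorem contDiff_stratumProj : ContDiff ℝ ∞ stratumProj := by
  have hc : ∀ i : Fin 4, ContDiff ℝ ∞ fun y : 𝔼⁴ => y i := fun i => contDiff_euclidean.mp contDiff_id i
  rw [contDiff_euclidean]
  intro i
  fin_cases i
  · exact contDiff_const
  · exact contDiff_const
  · exact hc 2
  · exact hc 3

/-- `stratumProj` is continuous. [folklore] -/
theorem continuous_stratumProj : Continuous stratumProj := contDiff_stratumProj.continuous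

/-- `stratumProj` commutes with `cornerUnbend` (which is the identity in the tangential
coordinates): `stratumProj (cornerUnbend x) = stratumProj x`. [folklore] -/
@[simp] theorem stratumProj_cornerUnbend (x : 𝔼⁴) : stratumProj (cornerUnbend x) = stratumProj x := by
  ext i; fin_cases i <;> rfl

/-- `stratumProj (cornerFold y) = stratumProj y`. [folklore] -/
@[simp] theorem stratumProj_cornerFold (y : 𝔼⁴) : stratumProj (cornerFold y) = stratumProj y := by
  ext i; fin_cases i <;> rfl

/-- `stratumProj` takes values in the corner stratum, hence in the quadrant. [folklore] -/
theorem stratumProj_mem_cornerQuadrant (x : 𝔼⁴) : stratumProj x ∈ cornerQuadrant :=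
  ⟨le_rfl, le_rfl⟩

/-- A vector with vanishing normal coordinates equals its stratum projection. [folklore] -/
theorem stratumProj_eq_self {x : 𝔼⁴} (h0 : x 0 = 0) (h1 : x 1 = 0) : stratumProj x = x := by
  ext i
  fin_cases i
  · exact h0.symm
  · exact h1.symm
  · rfl
  · rfl

/-- The value of `(𝓡∂ 4).symm` at a vector of the closed half-space is that vector. [folklore] -/
theorem modelHalf_symm_val {z : 𝔼⁴} (hz : 0 ≤ z 0) : ((𝓡∂ 4).symm z).val = z :=
  modelHalf_apply_symm (k := 3) hz

/-- For `y ∈ Q`, `cornerFold y` lies in the range of the half-space model. [folklore] -/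
theorem cornerFold_mem_range_modelHalf {y : 𝔼⁴} (hy : y ∈ cornerQuadrant) :
    cornerFold y ∈ range (𝓡∂ 4) :=
  mem_range_modelHalf (k := 3) (cornerFold_apply_zero_nonneg hy)

end Models

/-! ### Corner-slice charts -/

section CornerSlice

variable {M : Type u} [TopologicalSpace M] [ChartedSpace 𝔼⁴ M]

/-- A **corner-slice chart** for a subset `S` of a `4`-manifold `M` without boundary, relative to
the *corner locus* `K ⊆ M`, the *normal coordinates* `u v : M → ℝ` and the *tangential
retraction* `π : M → M`: an `ℝ⁴`-valued local diffeomorphism `Θ` of `M` (an open partial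
homeomorphism onto an open subset of `ℝ⁴`, smooth with smooth inverse) such that on its source
* `S` is the model quadrant: `q ∈ S ↔ Θ q ∈ Q = {y₀ ≥ 0, y₁ ≥ 0}`;
* the first two coordinates of `Θ` are `u` and `v`;
* `π` preserves the source and `Θ (π q) = (0, 0, (Θ q)₂, (Θ q)₃)`: `π` retracts the source onto
  its corner stratum along the normal coordinates, and the tangential coordinates `(Θ q)₂`,
  `(Θ q)₃` only depend on `π q`;
* `K` is the corner stratum: `q ∈ K ↔ u q = 0 ∧ v q = 0`.
This is the local model of a `4`-manifold with corners of index `2` embedded in `M` (Douady's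
"secteur adapté" of index `2`; Lee, Ch. 16), rigidified by the common normal coordinates and
the common tangential retraction so that any two corner-slice charts have transition map of
the form `(y₀, y₁, y') ↦ (y₀, y₁, τ(y'))`. [cite: Douady1961, §1 and §4] -/
structure CornerSliceChart (S K : Set M) (u v : M → ℝ) (π : M → M) where
  /-- The local diffeomorphism of `M` into `ℝ⁴`. -/
  Θ : OpenPartialHomeomorph M 𝔼⁴
  /-- It is smooth on its source. -/
  contMDiffOn_toFun : ContMDiffOn (𝓡 4) 𝓘(ℝ, 𝔼⁴) ∞ Θ Θ.source
  /-- Its inverse is smooth on its target. -/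
  contMDiffOn_symm : ContMDiffOn 𝓘(ℝ, 𝔼⁴) (𝓡 4) ∞ Θ.symm Θ.target
  /-- In the chart, `S` is the model quadrant. -/
  mem_iff : ∀ q ∈ Θ.source, q ∈ S ↔ Θ q ∈ cornerQuadrant
  /-- The first coordinate is the normal coordinate `u`. -/
  apply_zero : ∀ q ∈ Θ.source, Θ q 0 = u q
  /-- The second coordinate is the normal coordinate `v`. -/
  apply_one : ∀ q ∈ Θ.source, Θ q 1 = v q
  /-- The tangential retraction preserves the source. -/
  mapsTo_π : MapsTo π Θ.source Θ.source
  /-- The tangential retraction kills the normal coordinates and preserves the tangential ones. -/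
  apply_π : ∀ q ∈ Θ.source, Θ (π q) = stratumProj (Θ q)
  /-- In the chart, `K` is the corner stratum `{u = v = 0}`. -/
  mem_K_iff : ∀ q ∈ Θ.source, q ∈ K ↔ u q = 0 ∧ v q = 0

namespace CornerSliceChart

variable {S K : Set M} {u v : M → ℝ} {π : M → M} (C : CornerSliceChart S K u v π)

/-- Points of `S` are mapped into the quadrant. [cite: Douady1961, §1 and §4] -/
theorem apply_mem_cornerQuadrant {q : M} (hq : q ∈ C.Θ.source) (hqS : q ∈ S) :
    C.Θ q ∈ cornerQuadrant :=
  (C.mem_iff q hq).1 hqS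

/-- A corner-slice chart pulls the quadrant back into `S`. [cite: Douady1961, §1 and §4] -/
theorem symm_mem {y : 𝔼⁴} (hy : y ∈ C.Θ.target) (hyQ : y ∈ cornerQuadrant) : C.Θ.symm y ∈ S := by
  rw [C.mem_iff _ (C.Θ.map_target hy), C.Θ.right_inv hy]; exact hyQ

/-- Points of `K` in the source lie in `S` (the corner stratum lies in the quadrant).
[cite: Douady1961, §1 and §4] -/
theorem mem_of_mem_K {q : M} (hq : q ∈ C.Θ.source) (hqK : q ∈ K) : q ∈ S := by
  obtain ⟨hu, hv⟩ := (C.mem_K_iff q hq).1 hqK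
  rw [C.mem_iff q hq]
  exact ⟨by rw [C.apply_zero q hq, hu], by rw [C.apply_one q hq, hv]⟩

/-- A point of the source lies in `K` iff its image lies on the corner stratum.
[cite: Douady1961, §1 and §4] -/
theorem mem_K_iff_apply {q : M} (hq : q ∈ C.Θ.source) : q ∈ K ↔ C.Θ q 0 = 0 ∧ C.Θ q 1 = 0 := by
  rw [C.mem_K_iff q hq, C.apply_zero q hq, C.apply_one q hq]

/-- At a point of `K`, `Θ q = (0, 0, (Θ q)₂, (Θ q)₃)`. [cite: Douady1961, §1 and §4] -/
theorem apply_eq_stratumProj_of_mem_K {q : M} (hq : q ∈ C.Θ.source) (hqK : q ∈ K) :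
    C.Θ q = stratumProj (C.Θ q) := by
  obtain ⟨h0, h1⟩ := (C.mem_K_iff_apply hq).1 hqK
  exact (stratumProj_eq_self h0 h1).symm

/-- Off `K`, the image of a point of the source is off the corner stratum.
[cite: Douady1961, §1 and §4] -/
theorem apply_ne_zero_of_not_mem_K {q : M} (hq : q ∈ C.Θ.source) (hqK : q ∉ K) :
    C.Θ q 0 ≠ 0 ∨ C.Θ q 1 ≠ 0 := by
  rw [C.mem_K_iff_apply hq, not_and_or] at hqK
  exact hqK

/-- The retraction `π` maps the source into `K`. [cite: Douady1961, §1 and §4] -/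
theorem π_mem_K {q : M} (hq : q ∈ C.Θ.source) : π q ∈ K := by
  rw [C.mem_K_iff_apply (C.mapsTo_π hq), C.apply_π q hq]
  exact ⟨rfl, rfl⟩

/-- `π` is the identity on `K ∩ source` (both `q` and `π q` have the chart value
`(0, 0, (Θ q)₂, (Θ q)₃)`). [cite: Douady1961, §1 and §4] -/
theorem π_eq_self_of_mem_K {q : M} (hq : q ∈ C.Θ.source) (hqK : q ∈ K) : π q = q :=
  C.Θ.injOn (C.mapsTo_π hq) hq ((C.apply_π q hq).trans (C.apply_eq_stratumProj_of_mem_K hq hqK).symm)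

/-- For `y` in the target, its stratum projection is again in the target: it is the chart value
of `π (Θ⁻¹ y)`. [cite: Douady1961, §1 and §4] -/
theorem apply_π_symm {y : 𝔼⁴} (hy : y ∈ C.Θ.target) : C.Θ (π (C.Θ.symm y)) = stratumProj y := by
  rw [C.apply_π _ (C.Θ.map_target hy), C.Θ.right_inv hy]

/-- For `y` in the target, `stratumProj y` is in the target. [cite: Douady1961, §1 and §4] -/
theorem stratumProj_mem_target {y : 𝔼⁴} (hy : y ∈ C.Θ.target) : stratumProj y ∈ C.Θ.target := by
  rw [← C.apply_π_symm hy]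
  exact C.Θ.map_source (C.mapsTo_π (C.Θ.map_target hy))

/-- For `y` in the target, `π (Θ⁻¹ y) = Θ⁻¹ (stratumProj y)`. [cite: Douady1961, §1 and §4] -/
theorem π_symm_eq {y : 𝔼⁴} (hy : y ∈ C.Θ.target) : π (C.Θ.symm y) = C.Θ.symm (stratumProj y) := by
  rw [← C.apply_π_symm hy, C.Θ.left_inv (C.mapsTo_π (C.Θ.map_target hy))]

/-- A corner-slice chart of a manifold without boundary modelled on `ℝ⁴` itself is a chart of
the maximal `C^∞` atlas of `M`. [folklore] -/
theorem Θ_mem_maximalAtlas [IsManifold (𝓡 4) ∞ M] : C.Θ ∈ IsManifold.maximalAtlas (𝓡 4) ∞ M :=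
  OpenPartialHomeomorph.mem_maximalAtlas_of_contMDiffOn _ C.contMDiffOn_toFun C.contMDiffOn_symm

/-! #### The induced chart of `S`: straightening the angle -/

open Classical in
/-- **The chart of `S` induced by a corner-slice chart**, valued in the half-space model `ℍ⁴`:
fold the quadrant onto the half-space, `q ↦ cornerFold (Θ q)` ("the sector with its angle
along `K` straightened by the principal square root": the inverse is `y ↦ Θ⁻¹ (cornerUnbend y)`
on the target, the junk value `p` elsewhere). [cite: DouadyHerault1973, Appendice] -/
def chart (p : S) : OpenPartialHomeomorph S ℍ⁴ where
  source := Subtype.val ⁻¹' C.Θ.source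
  target := {y | cornerUnbend ((𝓡∂ 4) y) ∈ C.Θ.target}
  toFun q := (𝓡∂ 4).symm (cornerFold (C.Θ q.1))
  invFun y := if h : cornerUnbend ((𝓡∂ 4) y) ∈ C.Θ.target then
      ⟨C.Θ.symm (cornerUnbend ((𝓡∂ 4) y)), C.symm_mem h (cornerUnbend_mem_cornerQuadrant _)⟩ else p
  map_source' q hq := by
    simp only [mem_preimage] at hq
    have hQ := C.apply_mem_cornerQuadrant hq q.2
    show cornerUnbend ((𝓡∂ 4) ((𝓡∂ 4).symm (cornerFold (C.Θ q.1)))) ∈ C.Θ.target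
    rw [modelHalf_apply_symm (k := 3) (cornerFold_apply_zero_nonneg hQ), cornerUnbend_cornerFold hQ]
    exact C.Θ.map_source hq
  map_target' y hy := by
    have hy' : cornerUnbend ((𝓡∂ 4) y) ∈ C.Θ.target := hy
    simp only [hy', ↓reduceDIte, mem_preimage]
    exact C.Θ.map_target hy'
  left_inv' q hq := by
    simp only [mem_preimage] at hq
    have hQ := C.apply_mem_cornerQuadrant hq q.2
    have h1 : cornerUnbend ((𝓡∂ 4) ((𝓡∂ 4).symm (cornerFold (C.Θ q.1)))) = C.Θ q.1 := by
      rw [modelHalf_apply_symm (k := 3) (cornerFold_apply_zero_nonneg hQ), cornerUnbend_cornerFold hQ]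
    have h2 : cornerUnbend ((𝓡∂ 4) ((𝓡∂ 4).symm (cornerFold (C.Θ q.1)))) ∈ C.Θ.target := by
      rw [h1]; exact C.Θ.map_source hq
    simp only [h2, ↓reduceDIte]
    ext1
    simp only [h1]
    exact C.Θ.left_inv hq
  right_inv' y hy := by
    have hy' : cornerUnbend ((𝓡∂ 4) y) ∈ C.Θ.target := hy
    simp only [hy', ↓reduceDIte]
    rw [C.Θ.right_inv hy', cornerFold_cornerUnbend (modelHalf_apply_zero_nonneg (k := 3) y)]
    exact (𝓡∂ 4).left_inv y
  open_source := C.Θ.open_source.preimage continuous_subtype_val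
  open_target := C.Θ.open_target.preimage (continuous_cornerUnbend.comp (𝓡∂ 4).continuous)
  continuousOn_toFun :=
    (𝓡∂ 4).continuous_symm.comp_continuousOn
      ((continuous_cornerFold.comp_continuousOn C.Θ.continuousOn).comp
        continuous_subtype_val.continuousOn fun _ hq => hq)
  continuousOn_invFun := by
    rw [Topology.IsInducing.subtypeVal.continuousOn_iff]
    refine ContinuousOn.congr (f := fun y => C.Θ.symm (cornerUnbend ((𝓡∂ 4) y))) ?_ ?_
    · exact C.Θ.continuousOn_symm.comp (continuous_cornerUnbend.comp (𝓡∂ 4).continuous).continuousOn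
        fun y hy => hy
    · intro y hy
      have hy' : cornerUnbend ((𝓡∂ 4) y) ∈ C.Θ.target := hy
      simp [hy']

/-- The chart of `S` induced by `C`, as a function (definitional). [cite: DouadyHerault1973, Appendice] -/
theorem chart_apply (p q : S) : C.chart p q = (𝓡∂ 4).symm (cornerFold (C.Θ q.1)) := rfl

/-- The source of the chart of `S` induced by `C` (definitional). [cite: DouadyHerault1973, Appendice] -/
@[simp]
theorem chart_source (p : S) : (C.chart p).source = Subtype.val ⁻¹' C.Θ.source := rfl

/-- The target of the chart of `S` induced by `C`. [cite: DouadyHerault1973, Appendice] -/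
theorem mem_chart_target {p : S} {y : ℍ⁴} :
    y ∈ (C.chart p).target ↔ cornerUnbend ((𝓡∂ 4) y) ∈ C.Θ.target := Iff.rfl

/-- On its source, the chart of `S` read in `ℝ⁴` is `cornerFold ∘ Θ`. [cite: DouadyHerault1973, Appendice] -/
theorem modelHalf_chart_apply {p q : S} (hq : q ∈ (C.chart p).source) :
    (𝓡∂ 4) (C.chart p q) = cornerFold (C.Θ q.1) :=
  modelHalf_apply_symm (k := 3) (cornerFold_apply_zero_nonneg (C.apply_mem_cornerQuadrant hq q.2))

/-- On its target, the inverse of the chart of `S` is `Θ⁻¹ ∘ cornerUnbend`.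
[cite: DouadyHerault1973, Appendice] -/
theorem coe_chart_symm_of_mem {p : S} {y : ℍ⁴} (hy : y ∈ (C.chart p).target) :
    ((C.chart p).symm y).1 = C.Θ.symm (cornerUnbend ((𝓡∂ 4) y)) := by
  have hy' : cornerUnbend ((𝓡∂ 4) y) ∈ C.Θ.target := hy
  have : (C.chart p).symm y = ⟨C.Θ.symm (cornerUnbend ((𝓡∂ 4) y)),
      C.symm_mem hy' (cornerUnbend_mem_cornerQuadrant _)⟩ := dif_pos hy'
  rw [this]

/-- On its source, the extended chart of `S` is `cornerFold ∘ Θ`. [cite: DouadyHerault1973, Appendice] -/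
theorem extend_chart_apply {p q : S} (hq : q ∈ (C.chart p).source) :
    (C.chart p).extend (𝓡∂ 4) q = cornerFold (C.Θ q.1) := by
  rw [OpenPartialHomeomorph.extend_coe, comp_apply, C.modelHalf_chart_apply hq]

/-- The target of the extended chart of `S` induced by `C`. [cite: DouadyHerault1973, Appendice] -/
theorem mem_extend_chart_target {p : S} {z : 𝔼⁴} :
    z ∈ ((C.chart p).extend (𝓡∂ 4)).target ↔ 0 ≤ z 0 ∧ cornerUnbend z ∈ C.Θ.target := by
  rw [OpenPartialHomeomorph.extend_target, mem_inter_iff, mem_preimage, mem_chart_target,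
    range_modelWithCornersEuclideanHalfSpace]
  constructor
  · rintro ⟨h1, h2⟩
    have h2' : 0 ≤ z 0 := h2
    exact ⟨h2', by rwa [modelHalf_apply_symm (k := 3) h2'] at h1⟩
  · rintro ⟨h1, h2⟩
    exact ⟨by rwa [modelHalf_apply_symm (k := 3) h1], h1⟩

/-- On its target, the inverse of the extended chart of `S` is `Θ⁻¹ ∘ cornerUnbend`.
[cite: DouadyHerault1973, Appendice] -/
theorem coe_extend_chart_symm_of_mem {p : S} {z : 𝔼⁴} (hz0 : 0 ≤ z 0)
    (hz : cornerUnbend z ∈ C.Θ.target) :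
    (((C.chart p).extend (𝓡∂ 4)).symm z).1 = C.Θ.symm (cornerUnbend z) := by
  rw [OpenPartialHomeomorph.extend_coe_symm, comp_apply, C.coe_chart_symm_of_mem,
    modelHalf_apply_symm (k := 3) hz0]
  show cornerUnbend ((𝓡∂ 4) ((𝓡∂ 4).symm z)) ∈ C.Θ.target
  rwa [modelHalf_apply_symm (k := 3) hz0]

/-- The source of a transition map out of a chart induced by `C`, read in `ℝ⁴`: description of
its points. [cite: DouadyHerault1973, Appendice] -/
theorem mem_symm_trans_source {p : S} {e : OpenPartialHomeomorph S ℍ⁴} {z : 𝔼⁴}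
    (hz : z ∈ (𝓡∂ 4).symm ⁻¹' ((C.chart p).symm ≫ₕ e).source ∩ range (𝓡∂ 4)) :
    0 ≤ z 0 ∧ cornerUnbend z ∈ C.Θ.target ∧ (C.chart p).symm ((𝓡∂ 4).symm z) ∈ e.source ∧
      ((C.chart p).symm ((𝓡∂ 4).symm z)).1 = C.Θ.symm (cornerUnbend z) := by
  obtain ⟨hz, hzr⟩ := hz
  rw [range_modelWithCornersEuclideanHalfSpace] at hzr
  have hz0 : 0 ≤ z 0 := hzr
  simp only [mem_preimage, OpenPartialHomeomorph.trans_source, OpenPartialHomeomorph.symm_source,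
    mem_inter_iff, mem_chart_target, modelHalf_apply_symm (k := 3) hz0] at hz
  refine ⟨hz0, hz.1, hz.2, ?_⟩
  have htgt : (𝓡∂ 4).symm z ∈ (C.chart p).target := by
    rw [mem_chart_target, modelHalf_apply_symm (k := 3) hz0]; exact hz.1
  rw [C.coe_chart_symm_of_mem htgt, modelHalf_apply_symm (k := 3) hz0]

/-! #### Compatibility of two corner-slice charts -/

/-- **The transition map between two corner-slice charts, before folding**: for `y` in the
target of `C` with `Θ_C⁻¹ y` in the source of `C'`,
`Θ_{C'} (Θ_C⁻¹ y) = (y₀, y₁, (Θ_{C'} (Θ_C⁻¹ (stratumProj y)))₂, (Θ_{C'} (Θ_C⁻¹ (stratumProj y)))₃)`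
— the normal coordinates are preserved and the tangential ones only depend on the tangential
ones. [cite: Douady1961, §1 and §4] -/
theorem trans_apply (C' : CornerSliceChart S K u v π) {y : 𝔼⁴} (hy : y ∈ C.Θ.target)
    (hy' : C.Θ.symm y ∈ C'.Θ.source) :
    C'.Θ (C.Θ.symm y) = !₂[y 0, y 1, C'.Θ (C.Θ.symm (stratumProj y)) 2,
      C'.Θ (C.Θ.symm (stratumProj y)) 3] := by
  set q := C.Θ.symm y with hq
  have hqC : q ∈ C.Θ.source := C.Θ.map_target hy
  have hyq : C.Θ q = y := C.Θ.right_inv hy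
  have hπ : C'.Θ (π q) = stratumProj (C'.Θ q) := C'.apply_π q hy'
  have hπq : π q = C.Θ.symm (stratumProj y) := C.π_symm_eq hy
  ext i
  fin_cases i
  · show C'.Θ q 0 = y 0
    rw [C'.apply_zero q hy', ← C.apply_zero q hqC, hyq]
  · show C'.Θ q 1 = y 1
    rw [C'.apply_one q hy', ← C.apply_one q hqC, hyq]
  · show C'.Θ q 2 = C'.Θ (C.Θ.symm (stratumProj y)) 2
    rw [← hπq, hπ]; rfl
  · show C'.Θ q 3 = C'.Θ (C.Θ.symm (stratumProj y)) 3
    rw [← hπq, hπ]; rfl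

/-- **The transition map between two corner-slice charts, after folding**, is
`(x₀, x₁, x₂, x₃) ↦ (x₀, x₁, τ₂(x₂, x₃), τ₃(x₂, x₃))` with `τ = Θ_{C'} ∘ Θ_C⁻¹ ∘ stratumProj`:
`cornerFold (Θ_{C'} (Θ_C⁻¹ (cornerUnbend x)))` has this form for `x` in the half-space.
[cite: DouadyHerault1973, Appendice] -/
theorem fold_trans_apply (C' : CornerSliceChart S K u v π) {x : 𝔼⁴} (hx0 : 0 ≤ x 0)
    (hx : cornerUnbend x ∈ C.Θ.target) (hx' : C.Θ.symm (cornerUnbend x) ∈ C'.Θ.source) :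
    cornerFold (C'.Θ (C.Θ.symm (cornerUnbend x))) =
      !₂[x 0, x 1, C'.Θ (C.Θ.symm (stratumProj x)) 2, C'.Θ (C.Θ.symm (stratumProj x)) 3] := by
  rw [C.trans_apply C' hx hx', stratumProj_cornerUnbend]
  have h := cornerFold_cornerUnbend hx0
  have h0 : 2 * cornerUnbend x 0 * cornerUnbend x 1 = x 0 := by simpa using congrArg (· 0) h
  have h1 : cornerUnbend x 1 ^ 2 - cornerUnbend x 0 ^ 2 = x 1 := by simpa using congrArg (· 1) h
  ext i
  fin_cases i
  · simpa using h0
  · simpa using h1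
  · rfl
  · rfl

/-- The tangential part `x ↦ Θ_{C'} (Θ_C⁻¹ (stratumProj x))` of the folded transition map is
smooth on the open set where it is defined. [cite: DouadyHerault1973, Appendice] -/
theorem contDiffOn_trans_stratumProj (C' : CornerSliceChart S K u v π) :
    ContDiffOn ℝ ∞ (fun x => C'.Θ (C.Θ.symm (stratumProj x)))
      {x | stratumProj x ∈ C.Θ.target ∧ C.Θ.symm (stratumProj x) ∈ C'.Θ.source} := by
  have h1 : ContDiffOn ℝ ∞ (C'.Θ ∘ C.Θ.symm) (C.Θ.target ∩ C.Θ.symm ⁻¹' C'.Θ.source) := by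
    rw [← contMDiffOn_iff_contDiffOn]
    exact C'.contMDiffOn_toFun.comp (C.contMDiffOn_symm.mono inter_subset_left) fun z hz => hz.2
  exact h1.comp contDiff_stratumProj.contDiffOn fun x hx => ⟨hx.1, hx.2⟩

/-- **Compatibility of corner-slice charts.**  For two corner-slice charts `C`, `C'` (same
`S, K, u, v, π`), the transition map between the induced charts of `S`, read in `ℝ⁴` through
`𝓡∂ 4`, is `(x₀, x₁, x') ↦ (x₀, x₁, τ(x'))` with `τ` smooth, hence smooth — although
`cornerUnbend` is not differentiable along the corner stratum. [cite: DouadyHerault1973, Appendice] -/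
theorem contDiffOn_symm_trans (C' : CornerSliceChart S K u v π) (p p' : S) :
    ContDiffOn ℝ ∞ ((𝓡∂ 4) ∘ ((C.chart p).symm ≫ₕ C'.chart p') ∘ (𝓡∂ 4).symm)
      ((𝓡∂ 4).symm ⁻¹' ((C.chart p).symm ≫ₕ C'.chart p').source ∩ range (𝓡∂ 4)) := by
  have hc : ∀ i : Fin 4, ContDiff ℝ ∞ fun y : 𝔼⁴ => y i := fun i => contDiff_euclidean.mp contDiff_id i
  set T := fun x : 𝔼⁴ => C'.Θ (C.Θ.symm (stratumProj x)) with hT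
  -- the smooth model of the transition map
  have hmodel : ContDiffOn ℝ ∞ (fun x : 𝔼⁴ => (!₂[x 0, x 1, T x 2, T x 3] : 𝔼⁴))
      {x | stratumProj x ∈ C.Θ.target ∧ C.Θ.symm (stratumProj x) ∈ C'.Θ.source} := by
    have hT' := C.contDiffOn_trans_stratumProj C'
    rw [contDiffOn_euclidean]
    intro i
    fin_cases i
    · exact (hc 0).contDiffOn
    · exact (hc 1).contDiffOn
    · exact (contDiffOn_euclidean.mp hT') 2
    · exact (contDiffOn_euclidean.mp hT') 3
  refine (hmodel.mono ?_).congr ?_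
  · intro z hz
    obtain ⟨hz0, hzt, hzs, hval⟩ := C.mem_symm_trans_source hz
    have hzs' : C.Θ.symm (cornerUnbend z) ∈ C'.Θ.source := by
      rw [chart_source, mem_preimage, hval] at hzs; exact hzs
    refine ⟨?_, ?_⟩
    · have := C.stratumProj_mem_target hzt
      rwa [stratumProj_cornerUnbend] at this
    · have := C'.mapsTo_π hzs'
      rwa [C.π_symm_eq hzt, stratumProj_cornerUnbend] at this
  · intro z hz
    obtain ⟨hz0, hzt, hzs, hval⟩ := C.mem_symm_trans_source hz
    have hzs' : C.Θ.symm (cornerUnbend z) ∈ C'.Θ.source := by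
      rw [chart_source, mem_preimage, hval] at hzs; exact hzs
    simp only [comp_apply, OpenPartialHomeomorph.coe_trans, chart_apply]
    rw [hval, modelHalf_apply_symm (k := 3)]
    · exact C.fold_trans_apply C' hz0 hzt hzs'
    · exact cornerFold_apply_zero_nonneg
        (C'.apply_mem_cornerQuadrant hzs' (C.symm_mem hzt (cornerUnbend_mem_cornerQuadrant _)))

/-! #### Re-centring the tangential coordinates -/

/-- Translating a corner-slice chart by a vector of the corner stratum `{w₀ = w₁ = 0}` (used
to centre the induced chart of `S` at a given point of `K`). [cite: Douady1961, §1 and §4] -/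
def translate (w : 𝔼⁴) (hw0 : w 0 = 0) (hw1 : w 1 = 0) : CornerSliceChart S K u v π where
  Θ := C.Θ.transHomeomorph (Homeomorph.addRight w)
  contMDiffOn_toFun := by
    have h : ContMDiff 𝓘(ℝ, 𝔼⁴) 𝓘(ℝ, 𝔼⁴) ∞ fun z : 𝔼⁴ => z + w :=
      contMDiff_iff_contDiff.2 (contDiff_id.add contDiff_const)
    exact h.comp_contMDiffOn C.contMDiffOn_toFun
  contMDiffOn_symm := by
    have h : ContMDiff 𝓘(ℝ, 𝔼⁴) 𝓘(ℝ, 𝔼⁴) ∞ fun z : 𝔼⁴ => z + -w :=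
      contMDiff_iff_contDiff.2 (contDiff_id.add contDiff_const)
    exact C.contMDiffOn_symm.comp h.contMDiffOn fun z hz => hz
  mem_iff q hq := by
    rw [C.mem_iff q hq]
    show C.Θ q ∈ cornerQuadrant ↔ C.Θ q + w ∈ cornerQuadrant
    simp only [cornerQuadrant, mem_setOf_eq, PiLp.add_apply, hw0, hw1, add_zero]
  apply_zero q hq := by
    show (C.Θ q + w) 0 = u q
    rw [PiLp.add_apply, hw0, add_zero, C.apply_zero q hq]
  apply_one q hq := by
    show (C.Θ q + w) 1 = v q
    rw [PiLp.add_apply, hw1, add_zero, C.apply_one q hq]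
  mapsTo_π := C.mapsTo_π
  apply_π q hq := by
    show C.Θ (π q) + w = stratumProj (C.Θ q + w)
    rw [C.apply_π q hq]
    ext i
    fin_cases i
    · simp [hw0]
    · simp [hw1]
    · simp
    · simp
  mem_K_iff := C.mem_K_iff

/-- The local diffeomorphism of a translated corner-slice chart, as a function.
[cite: Douady1961, §1 and §4] -/
@[simp]
theorem translate_Θ_apply (w : 𝔼⁴) (hw0 : w 0 = 0) (hw1 : w 1 = 0) (q : M) :
    (C.translate w hw0 hw1).Θ q = C.Θ q + w := rfl

/-- The source of a translated corner-slice chart (definitional). [cite: Douady1961, §1 and §4] -/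
@[simp]
theorem translate_Θ_source (w : 𝔼⁴) (hw0 : w 0 = 0) (hw1 : w 1 = 0) :
    (C.translate w hw0 hw1).Θ.source = C.Θ.source := rfl

/-- At a point of `K`, the corner-slice chart translated by `-Θ p` (a vector of the stratum) is
centred: it maps `p` to `0`. [cite: Douady1961, §1 and §4] -/
theorem translate_Θ_apply_self {p : M} (hp : p ∈ C.Θ.source) (hpK : p ∈ K) :
    (C.translate (-C.Θ p) (by rw [PiLp.neg_apply, ((C.mem_K_iff_apply hp).1 hpK).1, neg_zero])
      (by rw [PiLp.neg_apply, ((C.mem_K_iff_apply hp).1 hpK).2, neg_zero])).Θ p = 0 := by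
  rw [translate_Θ_apply, add_neg_cancel]

/-! #### Compatibility with half-slice charts -/

/-- The source of a transition map out of a chart induced by a half-slice chart `D`, read in
`ℝ⁴`: description of its points. [folklore] -/
theorem _root_.Literature.Topology.FourManifolds.HalfSliceChart.mem_symm_trans_source
    (D : HalfSliceChart (𝓡 4) S) {p : S} {e : OpenPartialHomeomorph S ℍ⁴} {z : 𝔼⁴}
    (hz : z ∈ (𝓡∂ 4).symm ⁻¹' ((D.chart p).symm ≫ₕ e).source ∩ range (𝓡∂ 4)) :
    0 ≤ z 0 ∧ z ∈ D.Θ.target ∧ (D.chart p).symm ((𝓡∂ 4).symm z) ∈ e.source ∧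
      ((D.chart p).symm ((𝓡∂ 4).symm z)).1 = D.Θ.symm z := by
  obtain ⟨hz, hzr⟩ := hz
  rw [range_modelWithCornersEuclideanHalfSpace] at hzr
  have hz0 : 0 ≤ z 0 := hzr
  simp only [mem_preimage, OpenPartialHomeomorph.trans_source, OpenPartialHomeomorph.symm_source,
    mem_inter_iff, HalfSliceChart.mem_chart_target, modelHalf_apply_symm (k := 3) hz0] at hz
  refine ⟨hz0, hz.1, hz.2, ?_⟩
  have htgt : (𝓡∂ 4).symm z ∈ (D.chart p).target := by
    rw [HalfSliceChart.mem_chart_target, modelHalf_apply_symm (k := 3) hz0]; exact hz.1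
  rw [D.coe_chart_symm_of_mem htgt, modelHalf_apply_symm (k := 3) hz0]

/-- **Compatibility, half-slice chart followed by corner-slice chart**: the transition map
`cornerFold ∘ Θ_C ∘ Θ_D⁻¹` is smooth (`cornerFold` is polynomial). [cite: DouadyHerault1973, Appendice] -/
theorem contDiffOn_halfSlice_symm_trans (D : HalfSliceChart (𝓡 4) S) (p p' : S) :
    ContDiffOn ℝ ∞ ((𝓡∂ 4) ∘ ((D.chart p).symm ≫ₕ C.chart p') ∘ (𝓡∂ 4).symm)
      ((𝓡∂ 4).symm ⁻¹' ((D.chart p).symm ≫ₕ C.chart p').source ∩ range (𝓡∂ 4)) := by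
  have key : ContDiffOn ℝ ∞ (cornerFold ∘ C.Θ ∘ D.Θ.symm) (D.Θ.target ∩ D.Θ.symm ⁻¹' C.Θ.source) := by
    have h1 : ContDiffOn ℝ ∞ (C.Θ ∘ D.Θ.symm) (D.Θ.target ∩ D.Θ.symm ⁻¹' C.Θ.source) := by
      rw [← contMDiffOn_iff_contDiffOn]
      exact C.contMDiffOn_toFun.comp (D.contMDiffOn_symm.mono inter_subset_left) fun z hz => hz.2
    exact contDiff_cornerFold.comp_contDiffOn h1
  refine (key.mono ?_).congr ?_
  · intro z hz
    obtain ⟨-, hzt, hzs, hval⟩ := D.mem_symm_trans_source hz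
    rw [chart_source, mem_preimage, hval] at hzs
    exact ⟨hzt, hzs⟩
  · intro z hz
    obtain ⟨hz0, hzt, hzs, hval⟩ := D.mem_symm_trans_source hz
    have hzs' : D.Θ.symm z ∈ C.Θ.source := by rw [chart_source, mem_preimage, hval] at hzs; exact hzs
    simp only [comp_apply, OpenPartialHomeomorph.coe_trans, chart_apply]
    rw [hval, modelHalf_apply_symm (k := 3)]
    exact cornerFold_apply_zero_nonneg (C.apply_mem_cornerQuadrant hzs' (D.symm_mem hzt hz0))

/-- `cornerUnbend z` lies on the corner stratum only if `z₀ = z₁ = 0`.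
[cite: DouadyHerault1973, Appendice] -/
theorem _root_.Literature.Topology.FourManifolds.apply_ne_zero_of_cornerUnbend_apply_ne_zero
    {z : 𝔼⁴} (h : cornerUnbend z 0 ≠ 0 ∨ cornerUnbend z 1 ≠ 0) :
    z 0 ≠ 0 ∨ z 1 ≠ 0 := by
  by_contra hc
  simp only [not_or, not_not] at hc
  have hcu := cornerUnbend_of_apply_zero_eq_zero_of_nonneg hc.1 (le_of_eq hc.2.symm)
  rw [hc.2, Real.sqrt_zero] at hcu
  rcases h with h | h
  · exact h (by rw [hcu]; rfl)
  · exact h (by rw [hcu]; rfl)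

/-- **Compatibility, corner-slice chart followed by a half-slice chart avoiding `K`**: the
transition map `Θ_D ∘ Θ_C⁻¹ ∘ cornerUnbend` is smooth within the half-space, because off `K`
the corner-slice chart takes values off the corner stratum, where `cornerUnbend` is smooth
within the half-space (`contDiffWithinAt_cornerUnbend`). [cite: DouadyHerault1973, Appendice] -/
theorem contDiffOn_symm_trans_halfSlice (D : HalfSliceChart (𝓡 4) S)
    (hD : ∀ q ∈ D.Θ.source, q ∉ K) (p p' : S) :
    ContDiffOn ℝ ∞ ((𝓡∂ 4) ∘ ((C.chart p).symm ≫ₕ D.chart p') ∘ (𝓡∂ 4).symm)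
      ((𝓡∂ 4).symm ⁻¹' ((C.chart p).symm ≫ₕ D.chart p').source ∩ range (𝓡∂ 4)) := by
  have key : ContDiffOn ℝ ∞ (D.Θ ∘ C.Θ.symm) (C.Θ.target ∩ C.Θ.symm ⁻¹' D.Θ.source) := by
    rw [← contMDiffOn_iff_contDiffOn]
    exact D.contMDiffOn_toFun.comp (C.contMDiffOn_symm.mono inter_subset_left) fun z hz => hz.2
  have hopen : IsOpen (C.Θ.target ∩ C.Θ.symm ⁻¹' D.Θ.source) :=
    C.Θ.continuousOn_symm.isOpen_inter_preimage C.Θ.open_target D.Θ.open_source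
  intro z hz
  obtain ⟨hz0, hzt, hzs, hval⟩ := C.mem_symm_trans_source hz
  have hzs' : C.Θ.symm (cornerUnbend z) ∈ D.Θ.source := by
    rw [HalfSliceChart.chart_source, mem_preimage, hval] at hzs; exact hzs
  -- off `K`, hence off the corner stratum
  have hK : C.Θ.symm (cornerUnbend z) ∉ K := hD _ hzs'
  have hne : cornerUnbend z 0 ≠ 0 ∨ cornerUnbend z 1 ≠ 0 := by
    have := C.apply_ne_zero_of_not_mem_K (C.Θ.map_target hzt) hK
    rwa [C.Θ.right_inv hzt] at this
  have hz' : z 0 ≠ 0 ∨ z 1 ≠ 0 := apply_ne_zero_of_cornerUnbend_apply_ne_zero hne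
  have hcu : ContDiffWithinAt ℝ ∞ cornerUnbend {x : 𝔼⁴ | 0 ≤ x 0} z :=
    contDiffWithinAt_cornerUnbend hz0 hz'
  have hcomp : ContDiffWithinAt ℝ ∞ (D.Θ ∘ C.Θ.symm ∘ cornerUnbend) {x : 𝔼⁴ | 0 ≤ x 0} z :=
    (key.contDiffAt (hopen.mem_nhds ⟨hzt, hzs'⟩)).comp_contDiffWithinAt z hcu
  refine (hcomp.mono ?_).congr (fun y hy => ?_) ?_
  · rintro y ⟨-, hyr⟩
    rw [range_modelWithCornersEuclideanHalfSpace] at hyr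
    exact hyr
  · obtain ⟨hy0, hyt, hys, hyval⟩ := C.mem_symm_trans_source hy
    have hys' : C.Θ.symm (cornerUnbend y) ∈ D.Θ.source := by
      rw [HalfSliceChart.chart_source, mem_preimage, hyval] at hys; exact hys
    simp only [comp_apply, OpenPartialHomeomorph.coe_trans, HalfSliceChart.chart_apply]
    rw [hyval, modelHalf_apply_symm (k := 3)]
    exact D.apply_zero_nonneg hys' (C.symm_mem hyt (cornerUnbend_mem_cornerQuadrant _))
  · simp only [comp_apply, OpenPartialHomeomorph.coe_trans, HalfSliceChart.chart_apply]
    rw [hval, modelHalf_apply_symm (k := 3)]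
    exact D.apply_zero_nonneg hzs' (C.symm_mem hzt (cornerUnbend_mem_cornerQuadrant _))

end CornerSliceChart

/-! ### Corner-slice atlases: the straightened smooth structure on a sector -/

/-- A **corner-slice atlas** for `S ⊆ M` with corner locus `K`, normal coordinates `u, v` and
tangential retraction `π`: a half-slice chart *avoiding `K`* around every point of `S ∖ K`
(there `S` is a smooth domain: a half-space in a chart of `M`) and a corner-slice chart around
every point of `S ∩ K` (there `S` is the model quadrant). [cite: Douady1961, §1 and §4] -/
structure CornerSliceAtlas (S K : Set M) (u v : M → ℝ) (π : M → M) where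
  /-- The half-slice chart at a point of `S` off `K`. -/
  halfDatum : ∀ p : S, p.1 ∉ K → HalfSliceChart (𝓡 4) S
  /-- `p` lies in the source of its half-slice chart. -/
  half_mem_source : ∀ (p : S) (hp : p.1 ∉ K), p.1 ∈ (halfDatum p hp).Θ.source
  /-- The half-slice charts avoid `K`. -/
  half_not_mem : ∀ (p : S) (hp : p.1 ∉ K), ∀ q ∈ (halfDatum p hp).Θ.source, q ∉ K
  /-- The corner-slice chart at a point of `S ∩ K`. -/
  cornerDatum : ∀ p : S, p.1 ∈ K → CornerSliceChart S K u v π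
  /-- `p` lies in the source of its corner-slice chart. -/
  corner_mem_source : ∀ (p : S) (hp : p.1 ∈ K), p.1 ∈ (cornerDatum p hp).Θ.source

namespace CornerSliceAtlas

variable {S K : Set M} {u v : M → ℝ} {π : M → M} (Φ : CornerSliceAtlas S K u v π)

open Classical in
/-- **The straightened smooth structure on a sector, charts.**  The atlas of `S` consists of the
charts of `S` induced by *all* half-slice charts avoiding `K` and by *all* corner-slice charts
(so that each of them is available as a compatible chart); the preferred chart at `p` is the
one induced by `Φ.cornerDatum p` if `p ∈ K` and by `Φ.halfDatum p` otherwise.  A `def`, not an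
instance: it depends on `Φ`. [cite: DouadyHerault1973, Appendice] -/
@[reducible]
def chartedSpace : ChartedSpace ℍ⁴ S where
  atlas := {e | ∃ (D : HalfSliceChart (𝓡 4) S) (p : S), (∀ q ∈ D.Θ.source, q ∉ K) ∧ D.chart p = e} ∪
    {e | ∃ (C : CornerSliceChart S K u v π) (p : S), C.chart p = e}
  chartAt p := if h : p.1 ∈ K then (Φ.cornerDatum p h).chart p else (Φ.halfDatum p h).chart p
  mem_chart_source p := by
    by_cases h : p.1 ∈ K
    · rw [dif_pos h]; exact Φ.corner_mem_source p h
    · rw [dif_neg h]; exact Φ.half_mem_source p h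
  chart_mem_atlas p := by
    by_cases h : p.1 ∈ K
    · rw [dif_pos h]; exact Or.inr ⟨Φ.cornerDatum p h, p, rfl⟩
    · rw [dif_neg h]; exact Or.inl ⟨Φ.halfDatum p h, p, Φ.half_not_mem p h, rfl⟩

open Classical in
/-- The preferred chart at a point of `K` (definitional). [cite: DouadyHerault1973, Appendice] -/
theorem chartAt_eq_of_mem (p : S) (hp : p.1 ∈ K) :
    letI := Φ.chartedSpace; chartAt (H := ℍ⁴) p = (Φ.cornerDatum p hp).chart p := by
  letI := Φ.chartedSpace
  show (if h : p.1 ∈ K then (Φ.cornerDatum p h).chart p else (Φ.halfDatum p h).chart p) = _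
  rw [dif_pos hp]

open Classical in
/-- The preferred chart at a point off `K` (definitional). [cite: DouadyHerault1973, Appendice] -/
theorem chartAt_eq_of_not_mem (p : S) (hp : p.1 ∉ K) :
    letI := Φ.chartedSpace; chartAt (H := ℍ⁴) p = (Φ.halfDatum p hp).chart p := by
  letI := Φ.chartedSpace
  show (if h : p.1 ∈ K then (Φ.cornerDatum p h).chart p else (Φ.halfDatum p h).chart p) = _
  rw [dif_neg hp]

/-- Every half-slice chart avoiding `K` induces a member of the atlas. [cite: DouadyHerault1973, Appendice] -/
theorem half_chart_mem_atlas (D : HalfSliceChart (𝓡 4) S) (hD : ∀ q ∈ D.Θ.source, q ∉ K) (q : S) :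
    letI := Φ.chartedSpace; D.chart q ∈ atlas (H := ℍ⁴) (M := S) :=
  Or.inl ⟨D, q, hD, rfl⟩

/-- Every corner-slice chart induces a member of the atlas. [cite: DouadyHerault1973, Appendice] -/
theorem corner_chart_mem_atlas (C : CornerSliceChart S K u v π) (q : S) :
    letI := Φ.chartedSpace; C.chart q ∈ atlas (H := ℍ⁴) (M := S) :=
  Or.inr ⟨C, q, rfl⟩

/-- **The straightened smooth structure on a sector, compatibility**: the charts induced by the
half-slice charts avoiding `K` and by the corner-slice charts form a `C^∞` atlas modelled on
`𝓡∂ 4` (the four kinds of transition maps: `HalfSliceChart.contDiffOn_symm_trans`,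
`CornerSliceChart.contDiffOn_halfSlice_symm_trans`, `CornerSliceChart.contDiffOn_symm_trans_halfSlice`,
`CornerSliceChart.contDiffOn_symm_trans`). [cite: DouadyHerault1973, Appendice] -/
theorem isManifold : letI := Φ.chartedSpace; IsManifold (𝓡∂ 4) ∞ S := by
  letI := Φ.chartedSpace
  apply isManifold_of_contDiffOn
  rintro e e' (⟨D, p, hD, rfl⟩ | ⟨C, p, rfl⟩) (⟨D', p', hD', rfl⟩ | ⟨C', p', rfl⟩)
  · exact D.contDiffOn_symm_trans D' p p'
  · exact C'.contDiffOn_halfSlice_symm_trans D p p'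
  · exact C.contDiffOn_symm_trans_halfSlice D' hD' p p'
  · exact C.contDiffOn_symm_trans C' p p'

/-! #### Boundary points -/

/-- **Points of the corner locus are boundary points** of the straightened sector: the preferred
chart there is `cornerFold ∘ Θ` and `Θ p` lies on the corner stratum, which `cornerFold` maps
into the boundary plane `{x₀ = 0}`. [cite: Douady1961, §1 and §4] -/
theorem isBoundaryPoint_of_mem (p : S) (hp : p.1 ∈ K) :
    letI := Φ.chartedSpace; (𝓡∂ 4).IsBoundaryPoint p := by
  letI := Φ.chartedSpace
  set C := Φ.cornerDatum p hp
  have hsrc : p ∈ (C.chart p).source := Φ.corner_mem_source p hp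
  rw [ModelWithCorners.IsBoundaryPoint, extChartAt, Φ.chartAt_eq_of_mem p hp,
    C.extend_chart_apply hsrc, frontier_range_modelWithCornersEuclideanHalfSpace]
  show 0 = cornerFold (C.Θ p.1) 0
  rw [eq_comm, cornerFold_apply_zero_eq_zero_iff]
  exact Or.inl ((C.mem_K_iff_apply (Φ.corner_mem_source p hp)).1 hp).1

/-- **Boundary points off the corner locus**: `p ∈ S ∖ K` is a boundary point of `S` iff its
`0`-th coordinate in the half-slice chart at `p` vanishes. [folklore] -/
theorem isBoundaryPoint_iff_of_not_mem (p : S) (hp : p.1 ∉ K) :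
    letI := Φ.chartedSpace; (𝓡∂ 4).IsBoundaryPoint p ↔ (Φ.halfDatum p hp).Θ p.1 0 = 0 := by
  letI := Φ.chartedSpace
  set D := Φ.halfDatum p hp
  have hsrc : p ∈ (D.chart p).source := Φ.half_mem_source p hp
  rw [ModelWithCorners.IsBoundaryPoint, extChartAt, Φ.chartAt_eq_of_not_mem p hp,
    D.extend_chart_apply hsrc, frontier_range_modelWithCornersEuclideanHalfSpace]
  exact ⟨fun h => Eq.symm h, fun h => Eq.symm h⟩

/-- **Interior points off the corner locus**: `p ∈ S ∖ K` is an interior point of `S` iff its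
`0`-th coordinate in the half-slice chart at `p` is positive. [folklore] -/
theorem isInteriorPoint_iff_of_not_mem (p : S) (hp : p.1 ∉ K) :
    letI := Φ.chartedSpace; (𝓡∂ 4).IsInteriorPoint p ↔ 0 < (Φ.halfDatum p hp).Θ p.1 0 := by
  letI := Φ.chartedSpace
  set D := Φ.halfDatum p hp
  have hsrc : p ∈ (D.chart p).source := Φ.half_mem_source p hp
  rw [ModelWithCorners.IsInteriorPoint, extChartAt, Φ.chartAt_eq_of_not_mem p hp,
    D.extend_chart_apply hsrc, interior_range_modelWithCornersEuclideanHalfSpace]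
  exact Iff.rfl

/-- Points of the corner locus lie in the boundary `(𝓡∂ 4).boundary S`. [cite: Douady1961, §1 and §4] -/
theorem mem_boundary_of_mem (p : S) (hp : p.1 ∈ K) :
    letI := Φ.chartedSpace; p ∈ (𝓡∂ 4).boundary S :=
  Φ.isBoundaryPoint_of_mem p hp

/-! #### The inclusion: corner charts on `K`, immersion off `K` -/

/-- **The inclusion of a straightened sector has a corner chart at every point of the corner
locus** (`Literature.Topology.FourManifolds.IsCornerAt`, with the linear part `A = id`): in the
induced chart of `S` re-centred at `p` and the corner-slice chart `Θ` of `M` (a member of the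
maximal atlas, `CornerSliceChart.Θ_mem_maximalAtlas`), the inclusion reads `cornerUnbend`.
This is the corner clause of `Literature.Topology.FourManifolds.IsGKTrisection` (ii) for a
sector presented by a corner-slice atlas. [cite: GayKirby2016, Def. 1] -/
theorem isCornerAt_subtype_val [IsManifold (𝓡 4) ∞ M] (p : S) (hp : p.1 ∈ K) :
    letI := Φ.chartedSpace; IsCornerAt (Subtype.val : S → M) p := by
  letI := Φ.chartedSpace
  haveI := Φ.isManifold
  set C₀ := Φ.cornerDatum p hp
  have hp₀ : p.1 ∈ C₀.Θ.source := Φ.corner_mem_source p hp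
  have hK := (C₀.mem_K_iff_apply hp₀).1 hp
  set C := C₀.translate (-C₀.Θ p.1) (by rw [PiLp.neg_apply, hK.1, neg_zero])
    (by rw [PiLp.neg_apply, hK.2, neg_zero]) with hC
  have hpC : p.1 ∈ C.Θ.source := hp₀
  have hCp : C.Θ p.1 = 0 := C₀.translate_Θ_apply_self hp₀ hp
  refine ⟨C.chart p, C.Θ, ContinuousLinearEquiv.refl ℝ 𝔼⁴,
    IsManifold.subset_maximalAtlas (Φ.corner_chart_mem_atlas C p), C.Θ_mem_maximalAtlas, hpC,
    fun q hq => hq, ?_, fun x hx => ?_⟩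
  · show ((𝓡∂ 4).symm (cornerFold (C.Θ p.1))).val = 0
    rw [hCp, cornerFold_eq_self rfl rfl, modelHalf_symm_val le_rfl]
  · rw [C.mem_extend_chart_target] at hx
    obtain ⟨hx0, hxt⟩ := hx
    simp only [ContinuousLinearEquiv.refl_symm, ContinuousLinearEquiv.refl_apply]
    rw [C.coe_extend_chart_symm_of_mem hx0 hxt, C.Θ.right_inv hxt]
    exact ⟨cornerUnbend_mem_cornerQuadrant x, cornerFold_cornerUnbend hx0⟩

/-- **The inclusion of a straightened sector is a `C^∞` immersion at every point off the corner
locus**: in the chart of `S` induced by the half-slice chart `Θₚ` at `p` and the chart `Θₚ` of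
`M` itself the inclusion reads `u ↦ u`, Mathlib's normal form with the trivial complement
`Fin 0 → ℝ`. [folklore] -/
theorem isImmersionAt_subtype_val [IsManifold (𝓡 4) ∞ M] (p : S) (hp : p.1 ∉ K) :
    letI := Φ.chartedSpace
    Manifold.IsImmersionAt (𝓡∂ 4) (𝓡 4) ∞ (Subtype.val : S → M) p := by
  letI := Φ.chartedSpace
  haveI := Φ.isManifold
  set D := Φ.halfDatum p hp with hD
  have hDmax : D.Θ ∈ IsManifold.maximalAtlas (𝓡 4) ∞ M :=
    OpenPartialHomeomorph.mem_maximalAtlas_of_contMDiffOn _ D.contMDiffOn_toFun D.contMDiffOn_symm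
  refine Manifold.IsImmersionAtOfComplement.isImmersionAt (F := Fin 0 → ℝ) ?_
  refine Manifold.IsImmersionAtOfComplement.mk_of_continuousAt
    continuous_subtype_val.continuousAt
    (ContinuousLinearEquiv.prodUnique ℝ 𝔼⁴ (Fin 0 → ℝ)) (D.chart p) D.Θ
    (show p ∈ (D.chart p).source from Φ.half_mem_source p hp) (Φ.half_mem_source p hp)
    (IsManifold.subset_maximalAtlas (Φ.half_chart_mem_atlas D (Φ.half_not_mem p hp) p)) hDmax ?_
  intro z hz
  rw [HalfSliceChart.mem_extend_chart_target] at hz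
  obtain ⟨hz0, hz1⟩ := hz
  simp only [comp_apply, OpenPartialHomeomorph.extend_coe, ContinuousLinearEquiv.prodUnique_apply,
    modelWithCornersSelf_coe, id_eq]
  rw [D.coe_extend_chart_symm_of_mem hz0 hz1, D.Θ.right_inv hz1]

end CornerSliceAtlas

/-! ### Half-slice charts near the corner locus, from a corner-slice chart -/

namespace CornerSliceChart

variable {S K : Set M} {u v : M → ℝ} {π : M → M} (C : CornerSliceChart S K u v π)

/-- The coordinate functions of `ℝ⁴` are smooth. [folklore] -/
private theorem contDiff_coord' (i : Fin 4) : ContDiff ℝ ∞ fun x : 𝔼⁴ => x i :=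
  contDiff_euclidean.mp contDiff_id i

/-- The open part `{Θ₁ > 0}` of the source of a corner-slice chart (a neighbourhood of the open
face `{u = 0, v > 0}` together with the open quadrant). [folklore] -/
theorem isOpen_source_inter_preimage_pos_one : IsOpen (C.Θ.source ∩ C.Θ ⁻¹' {y : 𝔼⁴ | 0 < y 1}) :=
  C.Θ.isOpen_inter_preimage (isOpen_lt continuous_const (contDiff_coord' 1).continuous)

/-- The open part `{Θ₀ > 0}` of the source of a corner-slice chart. [folklore] -/
theorem isOpen_source_inter_preimage_pos_zero : IsOpen (C.Θ.source ∩ C.Θ ⁻¹' {y : 𝔼⁴ | 0 < y 0}) :=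
  C.Θ.isOpen_inter_preimage (isOpen_lt continuous_const (contDiff_coord' 0).continuous)

/-- **The half-slice chart of the face `{u = 0}`**: the corner-slice chart restricted to
`{Θ₁ > 0}`, where `S = {Θ₀ ≥ 0}` is a half-space. [cite: Douady1961, §1 and §4] -/
def halfSliceOfPosOne : HalfSliceChart (𝓡 4) S where
  Θ := C.Θ.restrOpen _ C.isOpen_source_inter_preimage_pos_one
  contMDiffOn_toFun := C.contMDiffOn_toFun.mono (by
    rw [OpenPartialHomeomorph.restrOpen_source]; exact inter_subset_left)
  contMDiffOn_symm := C.contMDiffOn_symm.mono (by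
    rw [OpenPartialHomeomorph.restrOpen_toPartialEquiv, PartialEquiv.restr_target]
    exact inter_subset_left)
  mem_iff q hq := by
    have hq' : q ∈ C.Θ.source ∩ (C.Θ.source ∩ C.Θ ⁻¹' {y : 𝔼⁴ | 0 < y 1}) := hq
    have h1 : 0 < C.Θ q 1 := hq'.2.2
    rw [C.mem_iff q hq'.1, OpenPartialHomeomorph.coe_restrOpen]
    exact ⟨fun h => h.1, fun h => ⟨h, h1.le⟩⟩

/-- The source of `halfSliceOfPosOne`. [cite: Douady1961, §1 and §4] -/
theorem halfSliceOfPosOne_source :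
    C.halfSliceOfPosOne.Θ.source = C.Θ.source ∩ C.Θ ⁻¹' {y : 𝔼⁴ | 0 < y 1} := by
  show C.Θ.source ∩ (C.Θ.source ∩ C.Θ ⁻¹' {y : 𝔼⁴ | 0 < y 1}) = _
  rw [← inter_assoc, inter_self]

/-- `halfSliceOfPosOne` avoids `K`. [cite: Douady1961, §1 and §4] -/
theorem not_mem_K_of_mem_halfSliceOfPosOne_source {q : M} (hq : q ∈ C.halfSliceOfPosOne.Θ.source) :
    q ∉ K := by
  rw [halfSliceOfPosOne_source] at hq
  rw [C.mem_K_iff_apply hq.1, not_and_or]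
  exact Or.inr (ne_of_gt hq.2)

/-- **The half-slice chart of the face `{v = 0}`**: the corner-slice chart restricted to
`{Θ₀ > 0}` followed by the exchange of the coordinates `0` and `1`, where `S = {Θ₁ ≥ 0}`
becomes the half-space. [cite: Douady1961, §1 and §4] -/
def halfSliceOfPosZero : HalfSliceChart (𝓡 4) S where
  Θ := (C.Θ.restrOpen _ C.isOpen_source_inter_preimage_pos_zero).transHomeomorph
    (swapZeroOne (k := 3) (by norm_num)).toHomeomorph
  contMDiffOn_toFun := by
    have h : ContMDiff 𝓘(ℝ, 𝔼⁴) 𝓘(ℝ, 𝔼⁴) ∞ (swapZeroOne (k := 3) (by norm_num)) :=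
      (swapZeroOne (k := 3) (by norm_num)).contDiff.contMDiff
    exact h.comp_contMDiffOn (C.contMDiffOn_toFun.mono fun q hq => hq.1)
  contMDiffOn_symm := by
    have h : ContMDiff 𝓘(ℝ, 𝔼⁴) 𝓘(ℝ, 𝔼⁴) ∞ (swapZeroOne (k := 3) (by norm_num)).symm :=
      (swapZeroOne (k := 3) (by norm_num)).symm.contDiff.contMDiff
    have h' : ContMDiffOn 𝓘(ℝ, 𝔼⁴) (𝓡 4) ∞ (C.Θ.restrOpen _ C.isOpen_source_inter_preimage_pos_zero).symm
        (C.Θ.restrOpen _ C.isOpen_source_inter_preimage_pos_zero).target :=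
      C.contMDiffOn_symm.mono (by
        rw [OpenPartialHomeomorph.restrOpen_toPartialEquiv, PartialEquiv.restr_target]
        exact inter_subset_left)
    exact h'.comp h.contMDiffOn fun z hz => hz
  mem_iff q hq := by
    have hq' : q ∈ C.Θ.source ∩ (C.Θ.source ∩ C.Θ ⁻¹' {y : 𝔼⁴ | 0 < y 0}) := hq
    have h0 : 0 < C.Θ q 0 := hq'.2.2
    rw [C.mem_iff q hq'.1]
    show C.Θ q ∈ cornerQuadrant ↔ 0 ≤ swapZeroOne (k := 3) (by norm_num) (C.Θ q) 0
    rw [swapZeroOne_apply_zero]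
    exact ⟨fun h => h.2, fun h => ⟨h0.le, h⟩⟩

/-- The source of `halfSliceOfPosZero`. [cite: Douady1961, §1 and §4] -/
theorem halfSliceOfPosZero_source :
    C.halfSliceOfPosZero.Θ.source = C.Θ.source ∩ C.Θ ⁻¹' {y : 𝔼⁴ | 0 < y 0} := by
  show C.Θ.source ∩ (C.Θ.source ∩ C.Θ ⁻¹' {y : 𝔼⁴ | 0 < y 0}) = _
  rw [← inter_assoc, inter_self]

/-- `halfSliceOfPosZero` avoids `K`. [cite: Douady1961, §1 and §4] -/
theorem not_mem_K_of_mem_halfSliceOfPosZero_source {q : M} (hq : q ∈ C.halfSliceOfPosZero.Θ.source) :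
    q ∉ K := by
  rw [halfSliceOfPosZero_source] at hq
  rw [C.mem_K_iff_apply hq.1, not_and_or]
  exact Or.inl (ne_of_gt hq.2)

/-- **Off `K`, every point of `S` in the source of a corner-slice chart has a half-slice chart
avoiding `K`**: a point of the quadrant off the corner stratum has `Θ₁ > 0` or `Θ₀ > 0`.
[cite: Douady1961, §1 and §4] -/
theorem exists_halfSliceChart_of_not_mem_K {q : M} (hq : q ∈ C.Θ.source) (hqS : q ∈ S)
    (hqK : q ∉ K) :
    ∃ D : HalfSliceChart (𝓡 4) S, q ∈ D.Θ.source ∧ ∀ q' ∈ D.Θ.source, q' ∉ K := by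
  have hQ := C.apply_mem_cornerQuadrant hq hqS
  rcases C.apply_ne_zero_of_not_mem_K hq hqK with h | h
  · have h0 : 0 < C.Θ q 0 := lt_of_le_of_ne hQ.1 (Ne.symm h)
    refine ⟨C.halfSliceOfPosZero, ?_, fun q' hq' => C.not_mem_K_of_mem_halfSliceOfPosZero_source hq'⟩
    rw [halfSliceOfPosZero_source]; exact ⟨hq, h0⟩
  · have h1 : 0 < C.Θ q 1 := lt_of_le_of_ne hQ.2 (Ne.symm h)
    refine ⟨C.halfSliceOfPosOne, ?_, fun q' hq' => C.not_mem_K_of_mem_halfSliceOfPosOne_source hq'⟩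
    rw [halfSliceOfPosOne_source]; exact ⟨hq, h1⟩

end CornerSliceChart

/-! ### Summary: the sector clause of a Gay–Kirby trisection, smooth part -/

/-- **A subset presented by a corner-slice atlas satisfies the smooth-structure items of clause
(ii) of `Literature.Topology.FourManifolds.IsGKTrisection`** (with corner locus `K`): with the
straightened structure `Φ.chartedSpace`, `S` is a `C^∞` manifold with boundary modelled on
`𝓡∂ 4`, its inclusion is a topological embedding with image `S`, a `C^∞` immersion at every
point off `K` and has a corner chart at every point of `K`, and the points of `K` are boundary
points.  (The remaining items of the clause — compactness, connectedness, the handle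
decomposition and "the other sectors meet `S` in the image of the boundary" — depend on the
sector at hand.) [cite: GayKirby2016, Def. 1] -/
theorem CornerSliceAtlas.sector_smooth_clause [IsManifold (𝓡 4) ∞ M] {S K : Set M} {u v : M → ℝ}
    {π : M → M} (Φ : CornerSliceAtlas S K u v π) :
    letI := Φ.chartedSpace
    IsManifold (𝓡∂ 4) ∞ S ∧ Topology.IsEmbedding (Subtype.val : S → M) ∧
      range (Subtype.val : S → M) = S ∧
      (∀ w : S, w.1 ∉ K → Manifold.IsImmersionAt (𝓡∂ 4) (𝓡 4) ∞ (Subtype.val : S → M) w) ∧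
      (∀ w : S, w.1 ∈ K → IsCornerAt (Subtype.val : S → M) w) ∧
      (∀ w : S, w.1 ∈ K → w ∈ (𝓡∂ 4).boundary S) :=
  ⟨Φ.isManifold, Topology.IsEmbedding.subtypeVal, Subtype.range_val,
    fun w hw => Φ.isImmersionAt_subtype_val w hw, fun w hw => Φ.isCornerAt_subtype_val w hw,
    fun w hw => Φ.mem_boundary_of_mem w hw⟩

end CornerSlice

end Literature.Topology.FourManifolds

end
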